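import Summits.ResolutionOfSingularities.ResolutionOfSingularities.Theorems.RadicialJungCleanModelsGiraudStepPoint
import HarnessLib

/-!
# Route `RadicialJung`, crux `CleanModels` (stmt-15917): Giraud's Lemme 2.3 at one point — the
# trichotomy `c′ < c ∨ (c′ = c ∧ n′ ≠ 1 ∧ n = 1)` per chart (T2: `stub_lemma23` modulo the
# scheme→chart bridge)

Support file (OURS) for PROGRAMME-clean-dim2 / T2, line `via-clean-models` of the crux
`DescentPerfectToAll` (stmt-0549). Nothing here is a statement of Hironaka's manuscript.

`stub_step` of the T2 skeleton is reduced (res-D-pv-030, `…T2StepOfLemma23.lean`,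
`exists_step_of_trichotomy`) to: for the blow-up of a Giraud-singular point `ξ` and every
Giraud-singular `ξ₁` over it, `c(ξ₁) < c(ξ) ∨ (c(ξ₁) = c(ξ) ∧ n(ξ₁) ≠ 1 ∧ n(ξ) = 1)`, `n` = the
number of critical primes (branches of `E`). Inside the function field, with
`R = 𝒪_{X,ξ} ≤ T = 𝒪_{X₁,ξ₁}` (`…T2BlowupStalkChart*.lean`: `T` is a localization of `R[y/x]` at a
maximal `Q`, or of `R[x/y]` at the origin), this file states that conclusion chart by chart, on
top of `RadicialJungCleanModelsGiraudStepPoint.lean`, with the critical primes of `R` and `T`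
given as explicit lists (geometry: `IsStrictNormalCrossingsAt` at `ξ`, `E(f₁) = π⁻¹E(f)` at `ξ₁`;
adapters in `…GiraudCriticalPrimesAdapters.lean`):

* `giraudColength_lt_of_chart` — `ξ₁` on the chart of `x` (`R[y/x] ≤ T`, `x ∈ Q`): in BOTH
  cases (`ξ` non-crossing with `E(f₁)` having the single branch `(x)` at `ξ₁`, or `ξ` crossing
  with branches among `(x), (y/x)`): **`c(T) < c(R)`**;
* `giraud23_trichotomy_of_oppositeChart_origin` — `ξ₁` = the origin of the chart of `y`
  (`R[x/y] ≤ T`, `y, x/y ∈ 𝔪_T`): **`c(T) < c(R) ∨ (c(T) = c(R) ∧ n(T) ≠ 1 ∧ n(R) = 1)`**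
  (non-crossing `ξ`: `c(T) ≤ c(R)`, `n(T) = 2`, `n(R) = 1`; crossing `ξ`: `c(T) < c(R)`).

References: J. Giraud, Bull. SMF 111 (1983), Lemme 2.3 [Giraud1983].
-/

noncomputable section

set_option linter.dupNamespace false -- mandated namespace of this single-conjunct summit

open IsLocalRing Literature.RingTheory.PBasis Literature.AlgebraicGeometry.Resolution

namespace Summit.ResolutionOfSingularities.ResolutionOfSingularities.Theorems.RadicialJung.CleanModels

universe u

variable {K : Type u} [Field K] {R T : Subring K} [IsRegularLocalRing R] {x y : R}
  {p : ℕ} [Fact p.Prime] [CharP R p] {Γ : Set R}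
  (δ : Γ → Derivation ℤ R R) (hδ₁ : ∀ γ : Γ, δ γ (γ : R) = 1)
  (hδ₀ : ∀ γ γ' : Γ, γ' ≠ γ → δ γ (γ' : R) = 0) (hx : x ∈ Γ) (hy : y ∈ Γ)

include hδ₁ hδ₀ hx hy in
/-- **Lemme 2.3 on the chart of `x`: `c(X₁, f₁, ξ₁) < c(X, f, ξ)`** in both cases — `ξ` a
non-crossing point (critical primes of `R` = `{(x)}`, of `T` = `{(x)}`) or a crossing point
(critical primes of `R` = `{(x), (y)}`, of `T` = the non-units among `(x), (y/x)`).
[cite: Giraud1983, Lemme 2.3 (i)–(iii)] -/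
theorem giraudColength_lt_of_chart (hdim : ringKrullDim R = 2)
    (hm : maximalIdeal R = Ideal.span {x, y}) (hxy : x ≠ y)
    (hΓ : IsPBasisOver p (frobenius R p).range Γ)
    [Module.Projective R Ω[R⁄ℤ]] [IsFractionRing R K]
    (hRT : R ≤ T) (hAT : chartAdjoin (K := K) x y ≤ T) (hyxT : ((y : R) : K) / x ∈ T)
    (hT : ∀ D : Derivation ℤ K K, (∀ r : R, D r ∈ R) → D (((y : R) : K) / x) ∈ T → ∀ t : T, D t ∈ T)
    [Algebra (chartAdjoin (K := K) x y) T]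
    (halgT : algebraMap (chartAdjoin (K := K) x y) T = Subring.inclusion hAT)
    (Q : Ideal (chartAdjoin (K := K) x y)) [Q.IsMaximal] (hxQ : chartIncl x y x ∈ Q)
    [IsLocalization.AtPrime T Q]
    (f : R) (hf : f ∉ (frobenius R p).range) (hc : giraudColength R f ≠ 0)
    (hcase : ((∀ P : Ideal R, P ∈ derivCriticalPrimes R f ↔ P = Ideal.span {x}) ∧
        (∀ P : Ideal T, P ∈ derivCriticalPrimes T (Subring.inclusion hRT f) ↔
          P = Ideal.span {Subring.inclusion hRT x})) ∨
      ((∀ P : Ideal R, P ∈ derivCriticalPrimes R f ↔ (P = Ideal.span {x} ∨ P = Ideal.span {y})) ∧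
        (∀ P : Ideal T, P ∈ derivCriticalPrimes T (Subring.inclusion hRT f) ↔
          ((¬ IsUnit (Subring.inclusion hRT x) ∧ P = Ideal.span {Subring.inclusion hRT x}) ∨
            (¬ IsUnit (⟨((y : R) : K) / x, hyxT⟩ : T) ∧
              P = Ideal.span {(⟨((y : R) : K) / x, hyxT⟩ : T)}))))) :
    giraudColength T (Subring.inclusion hRT f) < giraudColength R f := by
  rcases hcase with ⟨hcritR, hcritT⟩ | ⟨hcritR, hcritT⟩
  · exact giraudColength_lt_of_nonCrossing_chart δ hδ₁ hδ₀ hx hy hdim hm hxy hΓ hRT hAT hT halgT Q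
      hxQ f hf hcritR hc (logDerivJacobianIdeal_eq_span_log _ hcritT)
  · exact giraudColength_lt_of_crossing_chart δ hδ₁ hδ₀ hx hy hdim hm hxy hΓ hRT hAT hyxT hT halgT
      Q f hf hcritR hc (logDerivJacobianIdeal_eq_span_log₂ _ hcritT)

include hδ₁ hδ₀ hx hy in
/-- **Lemme 2.3 at the origin of the chart of `y`** (`R[x/y] ≤ T`, `y` and `x/y` non-units of
`T`: the crossing point of `E(f₁)` with the strict transform of `{x = 0}`): the trichotomy
**`c(T) < c(R) ∨ (c(T) = c(R) ∧ n(T) ≠ 1 ∧ n(R) = 1)`** — for `ξ` non-crossing (critical primes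
`{(x)}` in `R`, `{(y), (x/y)}` in `T`, distinct) `c(T) ≤ c(R)`, `n(T) = 2`, `n(R) = 1`; for `ξ`
crossing (`{(x), (y)}` in `R`, non-units among `(y), (x/y)` in `T`) `c(T) < c(R)`.
[cite: Giraud1983, Lemme 2.3 (i)–(iii)] -/
theorem giraud23_trichotomy_of_oppositeChart_origin (hdim : ringKrullDim R = 2)
    (hm : maximalIdeal R = Ideal.span {x, y}) (hxy : x ≠ y)
    (hΓ : IsPBasisOver p (frobenius R p).range Γ)
    [Module.Projective R Ω[R⁄ℤ]] [IsFractionRing R K]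
    (hRT : R ≤ T) (hAT : chartAdjoin (K := K) y x ≤ T) (hxyT : ((x : R) : K) / y ∈ T)
    (hT : ∀ D : Derivation ℤ K K, (∀ r : R, D r ∈ R) → D (((x : R) : K) / y) ∈ T → ∀ t : T, D t ∈ T)
    [Algebra (chartAdjoin (K := K) y x) T]
    (halgT : algebraMap (chartAdjoin (K := K) y x) T = Subring.inclusion hAT)
    (Q : Ideal (chartAdjoin (K := K) y x)) [Q.IsMaximal] [IsLocalization.AtPrime T Q]
    (f : R) (hf : f ∉ (frobenius R p).range) (hc : giraudColength R f ≠ 0)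
    (hne : (Ideal.span {Subring.inclusion hRT y} : Ideal T) ≠
      Ideal.span {(⟨((x : R) : K) / y, hxyT⟩ : T)})
    (hcase : ((∀ P : Ideal R, P ∈ derivCriticalPrimes R f ↔ P = Ideal.span {x}) ∧
        (∀ P : Ideal T, P ∈ derivCriticalPrimes T (Subring.inclusion hRT f) ↔
          (P = Ideal.span {Subring.inclusion hRT y} ∨
            P = Ideal.span {(⟨((x : R) : K) / y, hxyT⟩ : T)}))) ∨
      ((∀ P : Ideal R, P ∈ derivCriticalPrimes R f ↔ (P = Ideal.span {x} ∨ P = Ideal.span {y})) ∧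
        (∀ P : Ideal T, P ∈ derivCriticalPrimes T (Subring.inclusion hRT f) ↔
          ((¬ IsUnit (Subring.inclusion hRT y) ∧ P = Ideal.span {Subring.inclusion hRT y}) ∨
            (¬ IsUnit (⟨((x : R) : K) / y, hxyT⟩ : T) ∧
              P = Ideal.span {(⟨((x : R) : K) / y, hxyT⟩ : T)}))))) :
    giraudColength T (Subring.inclusion hRT f) < giraudColength R f ∨
      (giraudColength T (Subring.inclusion hRT f) = giraudColength R f ∧
        (derivCriticalPrimes T (Subring.inclusion hRT f)).ncard ≠ 1 ∧
        (derivCriticalPrimes R f).ncard = 1) := by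
  classical
  rcases hcase with ⟨hcritR, hcritT⟩ | ⟨hcritR, hcritT⟩
  · -- non-crossing `ξ`: `c(T) ≤ c(R)`, `n(T) = 2`, `n(R) = 1`
    have hJT : logDerivJacobianIdeal T (Subring.inclusion hRT f) =
        Ideal.span {w : T | ∃ D : Derivation ℤ T T,
          Subring.inclusion hRT y ∣ D (Subring.inclusion hRT y) ∧
          (⟨((x : R) : K) / y, hxyT⟩ : T) ∣ D ⟨((x : R) : K) / y, hxyT⟩ ∧
          D (Subring.inclusion hRT f) = w} := by
      unfold logDerivJacobianIdeal
      congr 1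
      ext w
      simp only [Set.mem_setOf_eq]
      constructor
      · rintro ⟨D, hD, rfl⟩
        exact ⟨D, (forall_mem_span_singleton_iff_dvd D _).mp (hD _ ((hcritT _).mpr (Or.inl rfl))),
          (forall_mem_span_singleton_iff_dvd D _).mp (hD _ ((hcritT _).mpr (Or.inr rfl))), rfl⟩
      · rintro ⟨D, hD₁, hD₂, rfl⟩
        refine ⟨D, fun P hP => ?_, rfl⟩
        rcases (hcritT P).mp hP with hP' | hP'
        · rw [hP']; exact (forall_mem_span_singleton_iff_dvd D _).mpr hD₁
        · rw [hP']; exact (forall_mem_span_singleton_iff_dvd D _).mpr hD₂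
    have hle := giraudColength_le_of_nonCrossing_oppositeChart δ hδ₁ hδ₀ hx hy hdim hm hxy hΓ hRT
      hAT hxyT hT halgT Q f hf hcritR hc hJT
    have hnR : (derivCriticalPrimes R f).ncard = 1 := by
      have : derivCriticalPrimes R f = {Ideal.span {x}} := Set.ext fun P => by
        rw [Set.mem_singleton_iff]; exact hcritR P
      rw [this, Set.ncard_singleton]
    have hnT : (derivCriticalPrimes T (Subring.inclusion hRT f)).ncard = 2 := by
      have : derivCriticalPrimes T (Subring.inclusion hRT f) =
          {Ideal.span {Subring.inclusion hRT y}, Ideal.span {(⟨((x : R) : K) / y, hxyT⟩ : T)}} :=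
        Set.ext fun P => by
          rw [Set.mem_insert_iff, Set.mem_singleton_iff]; exact hcritT P
      rw [this, Set.ncard_pair hne]
    rcases hle.lt_or_eq with hlt | heq
    · exact Or.inl hlt
    · exact Or.inr ⟨heq, by rw [hnT]; decide, hnR⟩
  · -- crossing `ξ`: strict drop, by the crossing theorem with the roles of `x, y` exchanged
    left
    have hm' : maximalIdeal R = Ideal.span {y, x} := by rw [hm, Set.pair_comm]
    have hcritR' : ∀ P : Ideal R, P ∈ derivCriticalPrimes R f ↔
        (P = Ideal.span {y} ∨ P = Ideal.span {x}) := fun P => (hcritR P).trans or_comm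
    exact giraudColength_lt_of_crossing_chart δ hδ₁ hδ₀ hy hx hdim hm' (Ne.symm hxy) hΓ hRT hAT hxyT
      hT halgT Q f hf hcritR' hc (logDerivJacobianIdeal_eq_span_log₂ _ hcritT)

end Summit.ResolutionOfSingularities.ResolutionOfSingularities.Theorems.RadicialJung.CleanModels

end
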